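import Literature.MathematicalPhysics.QuantumLattice.HubbardPartitionFunctionMatsubaraLimit
import Literature.MathematicalPhysics.QuantumLattice.MatsubaraTruncationConvergence
import HarnessLib

/-!
# Route `KLProgramme`, crux K3, child 4 `KLRegimeTwoPointAssembly`, stub `stub_asm_matsubara` —
# part C: the REMAINDER KERNEL of the Matsubara truncation (uniform bound, vanishing `L¹` mass)

Cell gate-hubbard-kl, seat t2 (HOME/t2/MATSUBARA-ALLU-SCOPE.md §2 (a), (h)).  The finite-frequency Wick entries of the Hubbard
Grassmann representation are `−[σ=σ'] L⁻² Σ_q e^{ip_q(x_a−x_b)} g_M(ξ_q, τ_b − τ_a)` with the sharply truncated propagator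
`g_M(ξ,u) = β⁻¹ Σ_{i} e^{−iω_i u}/(−iω_i + ξ)` (`vertexSub_pullback_zero_seed_apply_zero_one`); their `M → ∞` limits are the
time-ordered propagators `timeOrderedPropagator β ξ u` with the midpoint at `u = 0` (`tendsto_truncatedPropagator_bgm_of_abs_lt`).
The all-coupling identification splits `g_M = (time-ordered kernel, tie broken to 0⁻) + remainder`; the remainder is
controlled ONLY through the scalar majorant
`δ_M(u) = L⁻² Σ_q ( |g_M(ξ_q,u) − timeOrderedPropagator β ξ_q u| + ½·[u = 0] )` (the `½` is the distance from the midpoint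
to the one-sided value), and what the cluster-integral bound (parts A–B) needs about `w_M := δ_M² · 1_{[−β,β]}` is exactly:

* **`exists_remainderKernel`** — there are `K₀ ≥ 0` and measurable kernels `0 ≤ w_M ≤ K₀` (`M ∈ ℕ`), integrable, with
  `∫₀^β w_M(c − t) dt ≤ ∫ w_M` for every real `c`, `∫ w_M → 0` as `M → ∞` (dominated convergence from the POINTWISE
  convergence of the truncated propagator off `u ∈ {−β, 0, β}` — no rate and no Parseval needed), and
  `δ_M(u)² ≤ w_M(u)` for `|u| ≤ β`.

No definition is introduced: the kernel is packaged existentially, so that the consumers never spell it out.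
-/

namespace Summit.HubbardSuperconductivity.HubbardSuperconductivity.Theorems.MatsubaraAllU

set_option linter.dupNamespace false -- summit = problem name (single-conjunct summit), D-0017

open MeasureTheory Finset Filter Topology Literature.MathematicalPhysics.QuantumLattice
  Literature.Probability.LatticeModels
open scoped Nat

noncomputable section

variable {L : ℕ} [NeZero L]

/-- The truncated propagator `u ↦ g_M(ξ,u)` is continuous (a finite sum of exponentials). -/
theorem continuous_truncatedPropagator (β ξ : ℝ) (M : ℕ) :
    Continuous fun u : ℝ => (1 / (β : ℂ)) * ∑ i : MatsubaraIdx M,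
      Complex.exp (-(Complex.I * matsubaraFreq β M i * u)) * (1 / (-(Complex.I * matsubaraFreq β M i) + ξ)) := by
  refine continuous_const.mul (continuous_finsetSum _ fun i _ => Continuous.mul ?_ continuous_const)
  exact Complex.continuous_exp.comp ((continuous_const.mul Complex.continuous_ofReal).neg)

/-- The scalar remainder majorant
`δ_M(u) = L⁻² Σ_q (|g_M(ξ_q,u) − timeOrderedPropagator β ξ_q u| + ½·[u=0])` is measurable in `u`. -/
theorem measurable_remainderMajorant (β μ : ℝ) (M : ℕ) :
    Measurable fun u : ℝ => (1 / (L : ℝ) ^ 2) * ∑ q : TorusSite 2 L,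
      (‖(1 / (β : ℂ)) * ∑ i : MatsubaraIdx M, Complex.exp (-(Complex.I * matsubaraFreq β M i * u)) *
            (1 / (-(Complex.I * matsubaraFreq β M i) + nambuXi L μ q)) -
          ((timeOrderedPropagator β (nambuXi L μ q) u : ℝ) : ℂ)‖ + if u = 0 then (1 / 2 : ℝ) else 0) := by
  refine measurable_const.mul (Finset.measurable_sum _ fun q _ => Measurable.add ?_ ?_)
  · refine (Measurable.sub (continuous_truncatedPropagator β _ M).measurable ?_).norm
    exact Complex.measurable_ofReal.comp (measurable_timeOrderedPropagator β _)
  · exact Measurable.ite (measurableSet_singleton 0) measurable_const measurable_const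

/-- Uniform bound of the scalar remainder majorant on `|u| ≤ β`:
`0 ≤ δ_M(u) ≤ L⁻² Σ_q ((2 + β|ξ_q|/3) + e^{|ξ_q|β} + ½)`, for every `M`. -/
theorem remainderMajorant_nonneg_le {β : ℝ} (hβ : 0 < β) (μ : ℝ) (M : ℕ) {u : ℝ} (hu : |u| ≤ β) :
    0 ≤ (1 / (L : ℝ) ^ 2) * ∑ q : TorusSite 2 L,
      (‖(1 / (β : ℂ)) * ∑ i : MatsubaraIdx M, Complex.exp (-(Complex.I * matsubaraFreq β M i * u)) *
            (1 / (-(Complex.I * matsubaraFreq β M i) + nambuXi L μ q)) -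
          ((timeOrderedPropagator β (nambuXi L μ q) u : ℝ) : ℂ)‖ + if u = 0 then (1 / 2 : ℝ) else 0) ∧
    (1 / (L : ℝ) ^ 2) * ∑ q : TorusSite 2 L,
      (‖(1 / (β : ℂ)) * ∑ i : MatsubaraIdx M, Complex.exp (-(Complex.I * matsubaraFreq β M i * u)) *
            (1 / (-(Complex.I * matsubaraFreq β M i) + nambuXi L μ q)) -
          ((timeOrderedPropagator β (nambuXi L μ q) u : ℝ) : ℂ)‖ + if u = 0 then (1 / 2 : ℝ) else 0) ≤
      (1 / (L : ℝ) ^ 2) * ∑ q : TorusSite 2 L,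
        ((2 + β * |nambuXi L μ q| / 3) + Real.exp (|nambuXi L μ q| * β) + 1 / 2) := by
  refine ⟨by positivity, ?_⟩
  gcongr with q _
  · calc ‖(1 / (β : ℂ)) * ∑ i : MatsubaraIdx M, Complex.exp (-(Complex.I * matsubaraFreq β M i * u)) *
            (1 / (-(Complex.I * matsubaraFreq β M i) + nambuXi L μ q)) -
          ((timeOrderedPropagator β (nambuXi L μ q) u : ℝ) : ℂ)‖
        ≤ ‖(1 / (β : ℂ)) * ∑ i : MatsubaraIdx M, Complex.exp (-(Complex.I * matsubaraFreq β M i * u)) *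
            (1 / (-(Complex.I * matsubaraFreq β M i) + nambuXi L μ q))‖ +
          ‖((timeOrderedPropagator β (nambuXi L μ q) u : ℝ) : ℂ)‖ := norm_sub_le _ _
      _ ≤ (2 + β * |nambuXi L μ q| / 3) + Real.exp (|nambuXi L μ q| * β) := by
          refine add_le_add (norm_truncatedPropagator_bgm_le hβ _ u M) ?_
          rw [Complex.norm_real, Real.norm_eq_abs]
          refine (abs_timeOrderedPropagator_le β _ u).trans (Real.exp_le_exp.2 ?_)
          exact mul_le_mul_of_nonneg_left hu (abs_nonneg _)
  · split_ifs <;> norm_num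

/-- **The remainder kernel of the Matsubara truncation** (existential packaging, no definition).  For `L ≥ 1`, `β > 0`,
`μ ∈ ℝ` there are `K₀ ≥ 0` and kernels `w_M : ℝ → ℝ` (`M ∈ ℕ`; in fact `w_M = δ_M² · 1_{[−β,β]}`) such that:
`w_M` is measurable, `0 ≤ w_M ≤ K₀`, `w_M` is integrable, `∫₀^β w_M(c − t)dt ≤ ∫ w_M` for every real `c`,
`∫ w_M → 0` as `M → ∞`, and `δ_M(u)² ≤ w_M(u)` for `|u| ≤ β`, where
`δ_M(u) = L⁻² Σ_q (|g_M(ξ_q,u) − timeOrderedPropagator β ξ_q u| + ½·[u=0])` is the scalar majorant of the remainder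
entries (truncated minus tie-broken time-ordered propagator).  The vanishing of `∫ w_M` is dominated convergence: `w_M`
is uniformly bounded and tends to `0` at every `u ∈ (−β,β) ∖ {0}` by `tendsto_truncatedPropagator_bgm_of_abs_lt`. -/
theorem exists_remainderKernel (L : ℕ) [NeZero L] {β : ℝ} (hβ : 0 < β) (μ : ℝ) :
    ∃ (K₀ : ℝ) (wr : ℕ → ℝ → ℝ), 0 ≤ K₀ ∧ (∀ M, Measurable (wr M)) ∧ (∀ M u, 0 ≤ wr M u) ∧
      (∀ M u, wr M u ≤ K₀) ∧ (∀ M, Integrable (wr M)) ∧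
      (∀ M (c : ℝ), ∫ t in Set.Icc (0 : ℝ) β, wr M (c - t) ≤ ∫ u, wr M u) ∧
      Tendsto (fun M => ∫ u, wr M u) atTop (𝓝 0) ∧
      (∀ M (u : ℝ), |u| ≤ β →
        ((1 / (L : ℝ) ^ 2) * ∑ q : TorusSite 2 L,
          (‖(1 / (β : ℂ)) * ∑ i : MatsubaraIdx M, Complex.exp (-(Complex.I * matsubaraFreq β M i * u)) *
                (1 / (-(Complex.I * matsubaraFreq β M i) + nambuXi L μ q)) -
              ((timeOrderedPropagator β (nambuXi L μ q) u : ℝ) : ℂ)‖ + if u = 0 then (1 / 2 : ℝ) else 0)) ^ 2 ≤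
          wr M u) := by
  classical
  -- the scalar majorant and the kernel
  set δ : ℕ → ℝ → ℝ := fun M u => (1 / (L : ℝ) ^ 2) * ∑ q : TorusSite 2 L,
      (‖(1 / (β : ℂ)) * ∑ i : MatsubaraIdx M, Complex.exp (-(Complex.I * matsubaraFreq β M i * u)) *
            (1 / (-(Complex.I * matsubaraFreq β M i) + nambuXi L μ q)) -
          ((timeOrderedPropagator β (nambuXi L μ q) u : ℝ) : ℂ)‖ + if u = 0 then (1 / 2 : ℝ) else 0) with hδ
  set K₁ : ℝ := (1 / (L : ℝ) ^ 2) * ∑ q : TorusSite 2 L,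
      ((2 + β * |nambuXi L μ q| / 3) + Real.exp (|nambuXi L μ q| * β) + 1 / 2) with hK₁
  have hK₁0 : 0 ≤ K₁ := by positivity
  have hδm : ∀ M, Measurable (δ M) := fun M => measurable_remainderMajorant (L := L) β μ M
  have hδ0 : ∀ M u, |u| ≤ β → 0 ≤ δ M u ∧ δ M u ≤ K₁ := fun M u hu =>
    remainderMajorant_nonneg_le (L := L) hβ μ M hu
  set wr : ℕ → ℝ → ℝ := fun M => Set.indicator (Set.Icc (-β) β) fun u => δ M u ^ 2 with hwr
  have habs : ∀ {u : ℝ}, u ∈ Set.Icc (-β) β ↔ |u| ≤ β := fun {u} => by rw [Set.mem_Icc, abs_le]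
  have hwm : ∀ M, Measurable (wr M) := fun M => ((hδm M).pow_const 2).indicator measurableSet_Icc
  have hw0 : ∀ M u, 0 ≤ wr M u := fun M u => by
    simp only [hwr]
    exact Set.indicator_nonneg (fun _ _ => sq_nonneg _) _
  have hwK : ∀ M u, wr M u ≤ K₁ ^ 2 := by
    intro M u
    simp only [hwr, Set.indicator]
    split_ifs with h
    · obtain ⟨h0, h1⟩ := hδ0 M u (habs.1 h)
      exact pow_le_pow_left₀ h0 h1 2
    · positivity
  have hwIon : ∀ M, IntegrableOn (fun u => δ M u ^ 2) (Set.Icc (-β) β) volume := by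
    intro M
    refine Measure.integrableOn_of_bounded (M := K₁ ^ 2) (by rw [Real.volume_Icc]; exact ENNReal.ofReal_ne_top)
      ((hδm M).pow_const 2).aestronglyMeasurable ?_
    refine (ae_restrict_iff' measurableSet_Icc).2 (ae_of_all _ fun u hu => ?_)
    obtain ⟨h0, h1⟩ := hδ0 M u (habs.1 hu)
    rw [Real.norm_of_nonneg (sq_nonneg _)]
    exact pow_le_pow_left₀ h0 h1 2
  have hwI : ∀ M, Integrable (wr M) := fun M =>
    (integrable_indicator_iff measurableSet_Icc).2 (hwIon M)
  refine ⟨K₁ ^ 2, wr, by positivity, hwm, hw0, hwK, hwI, ?_, ?_, ?_⟩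
  · -- `∫₀^β w(c − t) dt ≤ ∫ w` (translation/reflection invariance of Lebesgue measure, `w ≥ 0`)
    intro M c
    calc ∫ t in Set.Icc (0 : ℝ) β, wr M (c - t)
        ≤ ∫ t, wr M (c - t) := setIntegral_le_integral ((hwI M).comp_sub_left c) (ae_of_all _ fun t => hw0 M _)
      _ = ∫ u, wr M u := integral_sub_left_eq_self _ _ c
  · -- `∫ w_M → 0`: dominated convergence on `[−β, β]`
    have hint : ∀ M, ∫ u, wr M u = ∫ u in Set.Icc (-β) β, δ M u ^ 2 := fun M =>
      integral_indicator measurableSet_Icc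
    simp_rw [hint]
    have hlim : Tendsto (fun M => ∫ u in Set.Icc (-β) β, δ M u ^ 2) atTop
        (𝓝 (∫ u in Set.Icc (-β) β, (0 : ℝ))) := by
      refine tendsto_integral_of_dominated_convergence (fun _ => K₁ ^ 2)
        (fun M => ((hδm M).pow_const 2).aestronglyMeasurable) ?_ (fun M => ?_) ?_
      · exact integrableOn_const (by rw [Real.volume_Icc]; exact ENNReal.ofReal_ne_top)
      · refine (ae_restrict_iff' measurableSet_Icc).2 (ae_of_all _ fun u hu => ?_)
        obtain ⟨h0, h1⟩ := hδ0 M u (habs.1 hu)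
        rw [Real.norm_of_nonneg (sq_nonneg _)]
        exact pow_le_pow_left₀ h0 h1 2
      · -- pointwise off the null set `{−β, 0, β}`
        have hnull : volume ({-β, 0, β} : Set ℝ) = 0 := (Set.toFinite _).measure_zero volume
        have hae : ∀ᵐ u ∂(volume : Measure ℝ), u ∉ ({-β, 0, β} : Set ℝ) := compl_mem_ae_iff.2 hnull
        filter_upwards [ae_restrict_mem measurableSet_Icc, ae_restrict_of_ae hae] with u hu hu'
        simp only [Set.mem_insert_iff, Set.mem_singleton_iff, not_or] at hu'
        have hu0 : u ≠ 0 := hu'.2.1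
        have hus : |u| < β := by
          rw [abs_lt]
          rcases hu with ⟨h1, h2⟩
          exact ⟨lt_of_le_of_ne h1 (Ne.symm hu'.1), lt_of_le_of_ne h2 hu'.2.2⟩
        have hq : ∀ q : TorusSite 2 L, Tendsto (fun M : ℕ =>
            ‖(1 / (β : ℂ)) * ∑ i : MatsubaraIdx M, Complex.exp (-(Complex.I * matsubaraFreq β M i * u)) *
                  (1 / (-(Complex.I * matsubaraFreq β M i) + nambuXi L μ q)) -
                ((timeOrderedPropagator β (nambuXi L μ q) u : ℝ) : ℂ)‖ + if u = 0 then (1 / 2 : ℝ) else 0)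
            atTop (𝓝 0) := by
          intro q
          rw [if_neg hu0]
          simpa using (tendsto_iff_norm_sub_tendsto_zero.1
            (tendsto_truncatedPropagator_bgm_of_abs_lt hβ (nambuXi L μ q) hus))
        have hδlim : Tendsto (fun M => δ M u) atTop (𝓝 0) := by
          have := (tendsto_finsetSum (Finset.univ : Finset (TorusSite 2 L)) fun q _ => hq q).const_mul
            (1 / (L : ℝ) ^ 2)
          simpa [hδ] using this
        simpa using hδlim.pow 2
    simpa using hlim
  · -- the key inequality (an equality on `|u| ≤ β`)
    intro M u hu
    simp only [hwr, Set.indicator_of_mem (habs.2 hu), hδ, le_refl]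

end

end Summit.HubbardSuperconductivity.HubbardSuperconductivity.Theorems.MatsubaraAllU
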